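import Literature.Computability.Cryptography.LWEDecisionToSearchAnalysis
import Literature.Computability.Cryptography.LWEDecisionToSearchQuery
import Literature.Computability.Complexity.TruthTableTransducers
import HarnessLib

/-!
# Discharge of `regev_decision_to_search` (pqc.S22; Regev 2009, Lemma 4.2 with Lemma 4.1): the output map (part IV) and the assembly (part V)

Sibling proof file of `Literature/Computability/Cryptography/LWEHardness.lean`, closing the series
`LWEDecisionToSearchSpec.lean` (I: layout, queries, decision rule, block laws),
`LWEDecisionToSearchAnalysis.lean` (II: the success probability), `LWEDecisionToSearchQuery.lean`
(III: the query generator is polynomial time). It proves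

* `Literature.Computability.Cryptography.regev_decision_to_search_holds : regev_decision_to_search q`

— for a prime, polynomially bounded modulus `q`, any noise `χ`, polynomially bounded `m` and all
`c, c'`, ONE probabilistic polynomial-time oracle algorithm `M` with a polynomially bounded sample
budget `m'` turns every oracle whose decision-LWE distinguisher on `m n` samples has (average-case)
advantage `≥ 1/n^c` for all large `n` into a search-LWE solver with success probability
`≥ 1 - 1/n^{c'}` for all large `n` (Regev 2009, §4: Lemma 4.1, Average-case to Worst-case, composed
with Lemma 4.2, Decision to Search; held copy arXiv:2401.03703, p. 23).

## Part IV — the output map is polynomial time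

The oracle machine is the truth-table transducer `ttFnAlgL Q X G` (`TruthTableTransducers.lean`); its
**output map** (the parsing bricks `xF`/`hqF`/`unF`/`uRF`/`uNF`/`uBF` of part III are reused: the
sample code sits at the same position of the step input) is

  `outFn pR pN pB pD : {0,1}* → {0,1}*`,
  `outFn ⟨⟨encodeLWESamples S, r⟩, code [a₀, a₁, …]⟩ = encodeSecret (Params.solveBits n q (b ↦ head bit of a_b))`

whenever the transcript holds at least `N + G·N` answers (`outFn_spec`), with `outFn_mem_FP`. The
decision rule `Params.solveBits` of part I is a nest of four counted loops, each one of the tree's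
generic `FP` loops:

* counting the accepted answers of an estimate (`posCntF`: `Brick.zipFoldLF` with `fcntF`, the coded
  answer list zipped with itself, `acc := acc + [head bit]`) — `cntU`, `cntX`;
* the threshold test `far` (`farGF`: `N ≤ 4 D |cX - cU|` by `Brick.subFn`/`addFn`/`prodFn`/`ltFn`);
* `passes i k = ∃ r < R, far …` — an OR-fold (`Brick.foldLoop` with `orBitOp`), `passesF`;
* `guess i =` the least passing `k < B` — a first-hit fold (`foldLoop` with `firstHitOp`; the piece
  carries `1ᵏ`, clipped), `guessUF`, in unary, reduced `mod q` and written in binary (`lenBinF`,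
  `remFn`);
* the secret's code `⟨⟨1ⁿ, ⟪bin ŝ₀, …, bin ŝ_{n-1}⟫⟩, ε⟩` — a concatenation fold (`foldLoop appF`,
  `foldAcc_appF`) of the pieces `⟨bin ŝᵢ, ε⟩` (`ccat_boolPair_nil_eq_encList`), `outFn`.

## Part V — the machine, the parameters, the discharge

* **The machine** `redAlg c c' Bq = ttFnAlgL (queryFn …) X (outFn …)`, both maps in `FP`, hence
  `M.IsPolyTime` (`isPolyTime_ttFnAlgL`); it uses NO coins (`coins = 0`: all its randomness — the
  shifts `t`, the scalars `l`, the self-made uniform samples — is read EXACTLY off the `a`-parts of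
  surplus input samples, which are uniform and independent under `A_{s,χ}`; so no `ℤ_q`-sampling
  error arises) and `fuel = 2X + 3` rounds.
* **Parameters** (polynomials in `n`, computed by the machine from `1ⁿ`): `D = n^c`, `B =` the
  polynomial bound of `q` (so `q n ≤ B`), `R = 4 n^{c+c'} + 1` shifts, `N = 128 n^{2c}(1 + nBR) n^{c'} + 1`
  calls per estimate; sample budget `m' n = K(n) · 2 m n`, `K = R + (N + nBR·N)` (polynomially
  bounded).
* **Correctness.** For all large `n` (prime `q n`, advantage `≥ 1/n^c`, `n ≥ 1`; the advantage
  hypothesis forces `m n ≥ 1`, `distinguishingAdvantage_zero_samples`), on input `encodeLWESamples S`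
  the run asks exactly the queries `encodeLWESamples (Params.qry S b)` (`queryFn_spec`), whose first
  answer bits are `acc (qry S b)` for the predicate `acc = [IsAccepting ∘ O ∘ encodeLWESamples]`, and
  outputs `encodeSecret (Params.solve acc S)` (`outFn_spec`, `Params.solveBits_congr`), whatever the
  (empty) coins: the solver IS the deterministic rule of part I (`solver_eq`). Part II
  (`le_searchSuccessProb_solve`) bounds its average success probability below by
  `1 - (2D/R + 64 D²(1 + nBR)/N) ≥ 1 - 1/n^{c'}` (`failBound_le`).

## References

* O. Regev, *On lattices, learning with errors, random linear codes, and cryptography*, J. ACM 56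
  (2009), art. 34, §4, Lemma 4.1 and Lemma 4.2 with their proofs (held copy arXiv:2401.03703, p. 23).
  [cite: RegevLWE2009, §4 Lemma 4.1–4.2]
* S. Arora, B. Barak, *Computational Complexity: A Modern Approach*, CUP 2009, §1.3 (polynomial
  time is closed under composition and polynomially bounded loops). [cite: AroraBarak2009, §1.3]
-/

noncomputable section

namespace Literature.Computability.Cryptography

namespace LWE

namespace DecisionToSearch

open _root_.Computability Polynomial Complexity Complexity.Brick Complexity.Plumb Complexity.OracleCompose
  Complexity.HashBricks

variable {n q m : ℕ}

/-! ### Generic fold operations -/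

/-- The value of a one-symbol numeral: `⟦[b]⟧ = b`. [folklore] -/
theorem bitsToNat_singleton (b : Bool) : bitsToNat [b] = b.toNat := by
  simp

/-- **The counting step**: `⟨z, ⟨prm, ⟨a, ⟨a', acc⟩⟩⟩⟩ ↦ bin (⟦acc⟧ + [head bit of a])`. [folklore] -/
noncomputable def fcntF : List Bool → List Bool := addFn ∘ fanoutFn (sndPow 3) (headBitFn ∘ nthF 2)

/-- Value of `fcntF` on a record. [folklore] -/
theorem fcntF_record (z p a b acc : List Bool) :
    fcntF (boolPair z (boolPair p (boolPair a (boolPair b acc)))) = encodeNat (bitsToNat acc + (a.headD false).toNat) := by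
  simp [fcntF]

/-- Growth of `fcntF`: `≤ |acc| + 2`. [folklore] -/
theorem length_fcntF_le (x p a b acc : List Bool) :
    (fcntF (boolPair x (boolPair p (boolPair a (boolPair b acc))))).length ≤
      acc.length + 2 * (a.length + b.length) + (2 : Polynomial ℕ).eval x.length := by
  rw [fcntF_record, eval_ofNat, ← bitsToNat_singleton]
  have h := length_encodeNat_add_le acc [a.headD false]
  simp only [List.length_cons, List.length_nil] at h
  omega

/-- `fcntF ∈ FP`. [folklore] -/
theorem fcntF_mem_FP : fcntF ∈ FP :=
  comp_mem_FP addFn_mem_FP (fanoutFn_mem_FP (sndPow_mem_FP 3) (comp_mem_FP headBitFn_mem_FP (nthF_mem_FP 2)))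

/-- **The counting fold**: folding `fcntF` over a list zipped with itself adds the head bits. [folklore] -/
theorem foldl_fcntF (z p : List Bool) : ∀ (L : List (List Bool)) (c : ℕ),
    (List.zip L L).foldl (fun acc ab => fcntF (boolPair z (boolPair p (boolPair ab.1 (boolPair ab.2 acc))))) (encodeNat c) =
      encodeNat (c + (L.map fun a => (a.headD false).toNat).sum)
  | [], c => by simp
  | a :: L, c => by
    rw [List.zip_cons_cons, List.foldl_cons, fcntF_record, bitsToNat_encodeNat, foldl_fcntF z p L, List.map_cons,
      List.sum_cons, add_assoc]

/-- **The OR operation** of the `passes` fold: `⟨acc, piece⟩ ↦ if head bit of piece then 1 else acc`. [folklore] -/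
noncomputable def orBitOp : List Bool → List Bool := iteFn (headBitFn ∘ sndF) (fun _ => [true]) fstF

/-- Value of `orBitOp`. [folklore] -/
theorem orBitOp_boolPair (acc piece : List Bool) : orBitOp (boolPair acc piece) = if piece.headD false then [true] else acc := by
  rw [orBitOp, iteFn_apply (b := piece.headD false) (by simp)]
  split_ifs <;> simp

/-- Growth of `orBitOp`: additive. [folklore] -/
theorem length_orOp_le (w : List Bool) : (orBitOp w).length ≤ (fstF w).length + (sndF w).length + 1 := by
  rw [orBitOp, iteFn_apply (b := (sndF w).headD false) (by simp)]
  split_ifs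
  · simp
  · omega

/-- `orBitOp ∈ FP`. [folklore] -/
theorem orBitOp_mem_FP : orBitOp ∈ FP :=
  iteFn_mem_FP (comp_mem_FP headBitFn_mem_FP sndF_mem_FP) (const_mem_FP _) fstF_mem_FP

/-- **The OR fold** from `[false]` computes `[∃ r < R, head bit of the r-th piece]`. [folklore] -/
theorem foldAcc_orOp (f : List Bool → List Bool) (x : List Bool) :
    ∀ R : ℕ, foldAcc orBitOp f x 0 R [false] = [decide (∃ r < R, (f (boolPair x (ones r))).headD false = true)]
  | 0 => by simp
  | R + 1 => by
    rw [foldAcc_succ', foldAcc_orOp f x R, orBitOp_boolPair, Nat.zero_add]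
    by_cases h : (f (boolPair x (ones R))).headD false = true
    · rw [if_pos h]
      simp only [List.cons.injEq, and_true]
      exact (decide_eq_true ⟨R, Nat.lt_succ_self R, h⟩).symm
    · rw [if_neg h]
      simp only [List.cons.injEq, and_true]
      congr 1
      refine propext ⟨fun ⟨r, hr, hb⟩ => ⟨r, by omega, hb⟩, fun ⟨r, hr, hb⟩ => ⟨r, ?_, hb⟩⟩
      rcases Nat.lt_succ_iff_lt_or_eq.1 hr with hr' | rfl
      · exact hr'
      · exact absurd hb h

/-- **The first-hit operation** of the `guess` fold on pieces `⟨bit, v⟩`: keep a found value, else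
record `1 v` if the bit is set. [folklore] -/
noncomputable def firstHitOp : List Bool → List Bool :=
  iteFn (isNilFn ∘ fstF) (iteFn (headBitFn ∘ fstF ∘ sndF) (List.cons true ∘ sndF ∘ sndF) (fun _ => [])) fstF

/-- Value of `firstHitOp`. [folklore] -/
theorem firstHitOp_boolPair (acc bit v : List Bool) :
    firstHitOp (boolPair acc (boolPair bit v)) = if acc = [] then (if bit.headD false then true :: v else []) else acc := by
  rw [firstHitOp, iteFn_apply (b := decide (acc = [])) (by simp [isNilFn])]
  by_cases h : acc = []
  · rw [if_pos (by simp [h]), if_pos h, iteFn_apply (b := bit.headD false) (by simp)]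
    split_ifs <;> simp
  · rw [if_neg (by simp [h]), if_neg h, fstF_boolPair]

/-- Growth of `firstHitOp`: additive. [folklore] -/
theorem length_firstOp_le (w : List Bool) : (firstHitOp w).length ≤ (fstF w).length + (sndF w).length + 1 := by
  rw [firstHitOp, iteFn_apply (b := decide (fstF w = [])) (by simp [isNilFn])]
  split_ifs
  · rw [iteFn_apply (b := (fstF (sndF w)).headD false) (by simp)]
    split_ifs
    · simp only [Function.comp_apply, List.length_cons]
      have := length_fstF_sndF_le (sndF w); omega
    · simp
  · omega

/-- `firstHitOp ∈ FP`. [folklore] -/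
theorem firstHitOp_mem_FP : firstHitOp ∈ FP :=
  iteFn_mem_FP (comp_mem_FP isNilFn_mem_FP fstF_mem_FP)
    (iteFn_mem_FP (comp_mem_FP headBitFn_mem_FP (comp_mem_FP fstF_mem_FP sndF_mem_FP))
      (comp_mem_FP (cons_mem_FP true) (comp_mem_FP sndF_mem_FP sndF_mem_FP)) (const_mem_FP _)) fstF_mem_FP

/-- **The first-hit fold** from `ε` over pieces `⟨[bₖ], 1ᵏ⟩`: `ε` if no bit is set, else `1 1ᵏ` for
the least `k` with `bₖ`. [folklore] -/
theorem foldAcc_firstOp (f : List Bool → List Bool) (x : List Bool) (b : ℕ → Bool) :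
    ∀ B : ℕ, (∀ k < B, f (boolPair x (ones k)) = boolPair [b k] (ones k)) →
      foldAcc firstHitOp f x 0 B [] = match (List.range B).find? b with | none => [] | some k => true :: ones k
  | 0, _ => by simp
  | B + 1, hf => by
    rw [foldAcc_succ', foldAcc_firstOp f x b B fun k hk => hf k (by omega), Nat.zero_add, hf B (by omega), List.range_succ,
      List.find?_append]
    cases h : (List.range B).find? b with
    | some k => simp [firstHitOp_boolPair]
    | none =>
      rw [firstHitOp_boolPair, if_pos rfl, Option.none_or]
      by_cases hb : b B = true
      · simp [hb]
      · simp [hb]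

/-- A coded list written piece by piece: `⟨c₀, ε⟩ ++ ⟨c₁, ε⟩ ++ ⋯ = ⟪c₀, c₁, …⟫` (twin of
`encList_append_singleton` of `Algebra/EuclideanLattices/FarCertMachineCodes.lean`, which is not in the
closure of this file's imports). [folklore] -/
theorem encList_append_singleton (L : List (List Bool)) (a : List Bool) :
    encList (L ++ [a]) = encList L ++ boolPair a [] := by
  induction L with
  | nil => simp [encList_cons, boolPair]
  | cons c L ih => rw [List.cons_append, encList_cons, encList_cons, ih]; simp [boolPair]

/-- **The concatenation of the pieces `⟨cⱼ, ε⟩` is the coded list of the `cⱼ`** (`ofFn` form; the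
`range`-form twin `ccat_boolPair_nil` lives in `Algebra/EuclideanLattices/FarCertMachineCodes.lean`, outside
the closure of this file's imports). [folklore] -/
theorem ccat_boolPair_nil_eq_encList (c : ℕ → List Bool) :
    ∀ k : ℕ, ccat (fun j => boolPair (c j) []) k = encList (List.ofFn fun i : Fin k => c i.val)
  | 0 => rfl
  | k + 1 => by
    rw [ccat_succ, ccat_boolPair_nil_eq_encList c k, List.ofFn_succ', List.concat_eq_append, encList_append_singleton]
    rfl

/-! ### The intended output-step input -/

/-- The output-step input for sample tuple `S`, second register `r` and answer transcript `ans`: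
`⟨⟨encodeLWESamples S, r⟩, code ans⟩`. [folklore] -/
def wOut (S : Fin m → (Fin n → ZMod q) × ZMod q) (r : List Bool) (ans : List (List Bool)) : List Bool :=
  boolPair (boolPair (encodeLWESamples S) r) ((encodingList Bool).listBool.encode ans)

/-- The coded answer list. [folklore] -/
def ansF : List Bool → List Bool := sndF ∘ sndF

/-- The answer bits read by the rule: the head bit of the `b`-th answer. [folklore] -/
def ansBits (ans : List (List Bool)) (b : ℕ) : Bool := (ans.getD b []).headD false

section WValues

variable (S : Fin m → (Fin n → ZMod q) × ZMod q) (r : List Bool) (ans : List (List Bool))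

/-- Parsing: the sample code. [folklore] -/
@[simp] theorem xF_wOut : xF (wOut S r ans) = encodeLWESamples S := by simp [xF, wOut]
/-- Parsing: the answers. [folklore] -/
@[simp] theorem ansF_wOut : ansF (wOut S r ans) = encList ans := by
  rw [ansF, Function.comp_apply, wOut, sndF_boolPair, code_eq_boolPair, sndF_boolPair]
  show ans.foldr (fun a acc => boolPair a acc) [] = _
  rw [show (fun a acc => boolPair a acc) = fun a acc => boolPair (id a) acc from rfl, foldr_boolPair_eq_encList, List.map_id]
/-- Parsing: `bin q`. [folklore] -/
@[simp] theorem hqF_wOut : hqF (wOut S r ans) = encodeNat q := by simp [hqF, encodeLWESamples_eq]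
/-- Parsing: `1ⁿ` (nonempty tuple). [folklore] -/
theorem unF_wOut (hm : 0 < m) : unF (wOut S r ans) = ones n := by
  simp only [unF, itemsF, Function.comp_apply, xF_wOut, encodeLWESamples_eq, sndPow_succ_boolPair, sndPow_zero, sndF_boolPair,
    fstF_lweBlockCode hm, fstF_fstF_lweSampleCode]
/-- The input is at least as long as the sample code. [folklore] -/
theorem length_encode_le_length_wOut : (encodeLWESamples S).length ≤ (wOut S r ans).length := by
  rw [wOut, length_boolPair, length_boolPair]; omega

end WValues

section PValues

variable (pR pN pB pD : Polynomial ℕ) (D : ℕ)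
variable (S : Fin ((PP pR pN pB D n).total n m) → (Fin n → ZMod q) × ZMod q) (r : List Bool) (ans : List (List Bool))

/-- `1^R`. [folklore] -/
theorem uRF_wOut (htot : 0 < (PP pR pN pB D n).total n m) : uRF pR (wOut S r ans) = ones (pR.eval n) := by
  simp [uRF, unF_wOut S r ans htot]
/-- `1^N`. [folklore] -/
theorem uNF_wOut (htot : 0 < (PP pR pN pB D n).total n m) : uNF pN (wOut S r ans) = ones (pN.eval n) := by
  simp [uNF, unF_wOut S r ans htot]
/-- `1^B`. [folklore] -/
theorem uBF_wOut (htot : 0 < (PP pR pN pB D n).total n m) : uBF pB (wOut S r ans) = ones (pB.eval n) := by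
  simp [uBF, unF_wOut S r ans htot]

/-- The basic lengths are dominated by the input: `m'`, `n`, `|bin q| ≤ |w|`. [folklore] -/
theorem lengths_le_wOut (htot : 0 < (PP pR pN pB D n).total n m) :
    (PP pR pN pB D n).total n m ≤ (wOut S r ans).length ∧ n ≤ (wOut S r ans).length ∧
      (encodeNat q).length ≤ (wOut S r ans).length := by
  obtain ⟨h1, h2, h3⟩ := le_length_encodeLWESamples htot S
  have h := length_encode_le_length_wOut S r ans
  exact ⟨h3.trans h, h1.trans h, h2.trans h⟩

/-- With `n, m, R, N ≥ 1` the parameters are dominated by the total: `R, N, B ≤ m'`. [folklore] -/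
theorem params_le_total (hn : 0 < n) (hm : 0 < m) (hR : 0 < pR.eval n) (hN : 0 < pN.eval n) :
    pR.eval n ≤ (PP pR pN pB D n).total n m ∧ pN.eval n ≤ (PP pR pN pB D n).total n m ∧
      pB.eval n ≤ (PP pR pN pB D n).total n m := by
  have hK : ∀ t, t ≤ (PP pR pN pB D n).K n → t ≤ (PP pR pN pB D n).total n m := fun t ht =>
    ht.trans (by show (PP pR pN pB D n).K n ≤ (PP pR pN pB D n).K n * (m + m); nlinarith)
  refine ⟨hK _ ?_, hK _ ?_, hK _ ?_⟩ <;> simp only [Params.K, Params.groups, PP_R, PP_N, PP_B]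
  · omega
  · omega
  · have : pB.eval n ≤ n * pB.eval n * pR.eval n * pN.eval n := by
      calc pB.eval n = 1 * pB.eval n * 1 * 1 := by ring
        _ ≤ n * pB.eval n * pR.eval n * pN.eval n := by gcongr <;> omega
    omega

end PValues

/-! ### Counting accepted answers -/

section Counting

variable (pN pD : Polynomial ℕ)

/-- The coded list of the answers from position `|pos v|` on, the record `v` holding the
output-step input at `W v`. [folklore] -/
noncomputable def ansFromF (W pos : List Bool → List Bool) : List Bool → List Bool :=
  dropLF ∘ fanoutFn id (fanoutFn (lenBinF ∘ pos) (ansF ∘ W))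

/-- **The count of accepted answers among the `N` from position `|pos v|` on**, as a binary numeral
(the coded answer list zipped with itself, folded with `fcntF`). [cite: RegevLWE2009, §4 (proof of Lemma 4.1: "estimate the acceptance probability of `W`")] -/
noncomputable def posCntF (W pos : List Bool → List Bool) : List Bool → List Bool :=
  zipFoldLF fcntF ∘ fanoutFn id (fanoutFn (lenBinF ∘ uNF pN ∘ W)
    (fanoutFn (fun _ => []) (fanoutFn (ansFromF W pos) (fanoutFn (ansFromF W pos) (fun _ => [])))))

/-- `posCntF W pos ∈ FP` for `W, pos ∈ FP`. [folklore] -/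
theorem posCntF_mem_FP {W pos : List Bool → List Bool} (hW : W ∈ FP) (hpos : pos ∈ FP) : posCntF pN W pos ∈ FP := by
  have hN : uNF pN ∈ FP := (params_mem_FP 0 pN 0).2.1
  have hA : ansFromF W pos ∈ FP := comp_mem_FP dropLF_mem_FP (fanoutFn_mem_FP OracleCompose.id_mem_FP
    (fanoutFn_mem_FP (comp_mem_FP lenBinF_mem_FP hpos) (comp_mem_FP (comp_mem_FP sndF_mem_FP sndF_mem_FP) hW)))
  exact comp_mem_FP (zipFoldLF_mem_FP fcntF_mem_FP length_fcntF_le) (fanoutFn_mem_FP OracleCompose.id_mem_FP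
    (fanoutFn_mem_FP (comp_mem_FP lenBinF_mem_FP (comp_mem_FP hN hW)) (fanoutFn_mem_FP (const_mem_FP _)
      (fanoutFn_mem_FP hA (fanoutFn_mem_FP hA (const_mem_FP _))))))

/-- The sum of the head bits of `N` consecutive answers, as a range sum. [folklore] -/
theorem sum_take_drop_eq_sum_range (g : List Bool → ℕ) (L : List (List Bool)) :
    ∀ (N p : ℕ), p + N ≤ L.length → (((L.drop p).take N).map g).sum = ∑ j ∈ Finset.range N, g (L.getD (p + j) [])
  | 0, p, _ => by simp
  | N + 1, p, h => by
    have hpN : p + N < L.length := by omega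
    rw [List.take_add_one, List.map_append, List.sum_append, sum_take_drop_eq_sum_range g L N p (by omega),
      Finset.sum_range_succ, List.getElem?_drop, List.getElem?_eq_getElem hpN, Option.toList_some, List.map_singleton,
      List.sum_singleton, List.getD_eq_getElem _ _ hpN]

/-- **Value of the count**: on a record `v` with `W v` the output-step input of a nonempty tuple,
`pos v = 1ᵖ`, `p, N ≤ |v|` and at least `p + N` answers, the count is `bin (Σ_{j<N} [bit (p+j)])`.
[folklore] -/
theorem posCntF_value {pR pB : Polynomial ℕ} {D : ℕ} {S : Fin ((PP pR pN pB D n).total n m) → (Fin n → ZMod q) × ZMod q}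
    {r : List Bool} {ans : List (List Bool)} (htot : 0 < (PP pR pN pB D n).total n m)
    {W pos : List Bool → List Bool} {v : List Bool} {p : ℕ} (hW : W v = wOut S r ans) (hpos : pos v = ones p)
    (hpv : p ≤ v.length) (hNv : pN.eval n ≤ v.length) (hans : p + pN.eval n ≤ ans.length) :
    posCntF pN W pos v = encodeNat (∑ j ∈ Finset.range (pN.eval n), (ansBits ans (p + j)).toNat) := by
  have hA : ansFromF W pos v = encList (ans.drop p) := by
    rw [ansFromF, Function.comp_apply, fanoutFn_apply, fanoutFn_apply, Function.comp_apply, Function.comp_apply, id, hpos, hW,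
      lenBinF_apply, List.length_replicate, ansF_wOut, dropLF_apply _ hpv]
  rw [posCntF, Function.comp_apply]
  simp only [fanoutFn_apply, Function.comp_apply, id]
  rw [hW, uNF_wOut pR pN pB D S r ans htot, hA, lenBinF_apply, List.length_replicate, zipFoldLF_apply fcntF v [] hNv,
    zipFoldValue, show ([] : List Bool) = encodeNat 0 from rfl, foldl_fcntF, Nat.zero_add,
    sum_take_drop_eq_sum_range _ ans _ p hans]
  rfl

end Counting

/-! ### The threshold test and the OR-fold over the shifts -/

section Far

variable (pR pN pB pD : Polynomial ℕ)

/-- The position `1^{N + g·N}` of the first answer of test group `g`, on records `v = ⟨w, 1ᵍ⟩`. [folklore] -/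
noncomputable def posXF : List Bool → List Bool :=
  concatFn ∘ fanoutFn (uNF pN ∘ fstF) (umulFn ∘ fanoutFn sndF (uNF pN ∘ fstF))

/-- The count `cX` of test group `g`, on `⟨w, 1ᵍ⟩`. [folklore] -/
noncomputable def cXF : List Bool → List Bool := posCntF pN fstF (posXF pN)

/-- The count `cU`, on `⟨w, 1ᵍ⟩`. [folklore] -/
noncomputable def cUF : List Bool → List Bool := posCntF pN fstF (fun _ => [])

/-- `bin |cX - cU|` (two truncated subtractions, one of which vanishes). [folklore] -/
noncomputable def absDiffF : List Bool → List Bool :=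
  addFn ∘ fanoutFn (subFn ∘ fanoutFn (cXF pN) (cUF pN)) (subFn ∘ fanoutFn (cUF pN) (cXF pN))

/-- **The threshold test on `⟨w, 1ᵍ⟩`**: the bit `[N ≤ 4 D |cX - cU|]` (`Params.far`).
[cite: RegevLWE2009, §4 (proof of Lemma 4.1: "If the two estimates differ by more than …")] -/
noncomputable def farGF : List Bool → List Bool :=
  notFn (ltFn ∘ fanoutFn (prodFn ∘ fanoutFn (lenBinF ∘ polyFn (4 * pD) ∘ unF ∘ fstF) (absDiffF pN)) (lenBinF ∘ uNF pN ∘ fstF))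

/-- `farGF` is one-bit. [folklore] -/
theorem oneBit_farGF : OneBit (farGF pN pD) := oneBit_notFn (oneBit_ltFn.comp _)

/-- `farGF ∈ FP`. [folklore] -/
theorem farGF_mem_FP : farGF pN pD ∈ FP := by
  have hN : uNF pN ∈ FP := (params_mem_FP 0 pN 0).2.1
  have hun : unF ∈ FP := parse_mem_FP.2.2.2.2.2.2
  have hpos : posXF pN ∈ FP := comp_mem_FP concatFn_mem_FP (fanoutFn_mem_FP (comp_mem_FP hN fstF_mem_FP)
    (comp_mem_FP umulFn_mem_FP (fanoutFn_mem_FP sndF_mem_FP (comp_mem_FP hN fstF_mem_FP))))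
  have hX : cXF pN ∈ FP := posCntF_mem_FP pN fstF_mem_FP hpos
  have hU : cUF pN ∈ FP := posCntF_mem_FP pN fstF_mem_FP (const_mem_FP _)
  have habs : absDiffF pN ∈ FP := comp_mem_FP addFn_mem_FP (fanoutFn_mem_FP (comp_mem_FP subFn_mem_FP (fanoutFn_mem_FP hX hU))
    (comp_mem_FP subFn_mem_FP (fanoutFn_mem_FP hU hX)))
  exact notFn_mem_FP (comp_mem_FP ltFn_mem_FP (fanoutFn_mem_FP (comp_mem_FP prodFn_mem_FP (fanoutFn_mem_FP
    (comp_mem_FP lenBinF_mem_FP (comp_mem_FP (polyFn_mem_FP _) (comp_mem_FP hun fstF_mem_FP))) habs))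
    (comp_mem_FP lenBinF_mem_FP (comp_mem_FP hN fstF_mem_FP))))

/-- `¬(a < b)` as a Boolean is `b ≤ a`. [folklore] -/
theorem not_decide_lt (a b : ℕ) : (!decide (a < b)) = decide (b ≤ a) := by
  rcases lt_or_ge a b with h | h
  · simp [h, not_le.2 h]
  · simp [not_lt.2 h, h]

/-- `(a ∸ c) + (c ∸ a) = |a - c|`. [folklore] -/
theorem tsub_add_tsub_eq_natAbs (a c : ℕ) : (a - c) + (c - a) = ((a : ℤ) - c).natAbs := by omega

variable {pR pN pB pD}

/-- **Value of the threshold test**: on `⟨wOut S r ans, 1ᵍ⟩` with `g = (i·B + k)·R + r` and enough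
answers, `farGF` computes `Params.far (cntX bits i k r) (cntU bits)` for the answer bits.
[cite: RegevLWE2009, §4 (proof of Lemma 4.1)] -/
theorem farGF_value {S : Fin ((PP pR pN pB (pD.eval n) n).total n m) → (Fin n → ZMod q) × ZMod q} {r : List Bool}
    {ans : List (List Bool)} (htot : 0 < (PP pR pN pB (pD.eval n) n).total n m)
    (hNtot : pN.eval n ≤ (PP pR pN pB (pD.eval n) n).total n m) {i k r' : ℕ}
    (hg : (PP pR pN pB (pD.eval n) n).gIdx i k r' < (PP pR pN pB (pD.eval n) n).groups n)
    (hans : (PP pR pN pB (pD.eval n) n).numQueries n ≤ ans.length) :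
    farGF pN pD (boolPair (wOut S r ans) (ones ((PP pR pN pB (pD.eval n) n).gIdx i k r'))) =
      [(PP pR pN pB (pD.eval n) n).far ((PP pR pN pB (pD.eval n) n).cntX (ansBits ans) i k r')
        ((PP pR pN pB (pD.eval n) n).cntU (ansBits ans))] := by
  obtain ⟨hle, -, -⟩ := lengths_le_wOut pR pN pB (pD.eval n) S r ans htot
  have hwv : (wOut S r ans).length ≤ (boolPair (wOut S r ans) (ones ((PP pR pN pB (pD.eval n) n).gIdx i k r'))).length := by
    rw [length_boolPair]; omega
  have hNv : pN.eval n ≤ (boolPair (wOut S r ans) (ones ((PP pR pN pB (pD.eval n) n).gIdx i k r'))).length :=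
    hNtot.trans (hle.trans hwv)
  have hgN : pN.eval n + (PP pR pN pB (pD.eval n) n).gIdx i k r' * pN.eval n + pN.eval n ≤ ans.length := by
    refine le_trans ?_ hans
    have : ((PP pR pN pB (pD.eval n) n).gIdx i k r' + 1) * pN.eval n ≤ (PP pR pN pB (pD.eval n) n).groups n * pN.eval n :=
      Nat.mul_le_mul_right _ hg
    show _ ≤ (PP pR pN pB (pD.eval n) n).N + (PP pR pN pB (pD.eval n) n).groups n * (PP pR pN pB (pD.eval n) n).N
    simp only [PP_N]; nlinarith
  have hansv : ans.length ≤ (boolPair (wOut S r ans) (ones ((PP pR pN pB (pD.eval n) n).gIdx i k r'))).length := by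
    have h1 : (encList ans).length ≤ (wOut S r ans).length := by
      have := length_fstF_sndF_le (wOut S r ans)
      have := length_fstF_sndF_le (sndF (wOut S r ans))
      have e : sndF (sndF (wOut S r ans)) = encList ans := ansF_wOut S r ans
      rw [← e]; omega
    have h2 := Com.length_le_length_encList ans
    omega
  have hcU : cUF pN (boolPair (wOut S r ans) (ones ((PP pR pN pB (pD.eval n) n).gIdx i k r'))) =
      encodeNat ((PP pR pN pB (pD.eval n) n).cntU (ansBits ans)) := by
    rw [cUF, posCntF_value pN htot (W := fstF) (pos := fun _ => []) (p := 0) (fstF_boolPair _ _) rfl (Nat.zero_le _) hNv (by omega)]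
    simp only [Nat.zero_add]
    rfl
  have hcX : cXF pN (boolPair (wOut S r ans) (ones ((PP pR pN pB (pD.eval n) n).gIdx i k r'))) =
      encodeNat ((PP pR pN pB (pD.eval n) n).cntX (ansBits ans) i k r') := by
    have hpos : posXF pN (boolPair (wOut S r ans) (ones ((PP pR pN pB (pD.eval n) n).gIdx i k r'))) =
        ones (pN.eval n + (PP pR pN pB (pD.eval n) n).gIdx i k r' * pN.eval n) := by
      rw [posXF, Function.comp_apply]
      simp only [fanoutFn_apply, Function.comp_apply, fstF_boolPair, sndF_boolPair, uNF_wOut pR pN pB _ S r ans htot,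
        concatFn_boolPair, umulFn_apply, List.length_replicate, Com.ones_append]
    rw [cXF, posCntF_value pN htot (W := fstF) (fstF_boolPair _ _) hpos (by omega) hNv hgN]
    unfold Params.cntX Params.xIdx
    simp only [PP_N, Nat.add_assoc]
  have habs : absDiffF pN (boolPair (wOut S r ans) (ones ((PP pR pN pB (pD.eval n) n).gIdx i k r'))) =
      encodeNat ((((PP pR pN pB (pD.eval n) n).cntX (ansBits ans) i k r' : ℤ) - (PP pR pN pB (pD.eval n) n).cntU (ansBits ans)).natAbs) := by
    rw [absDiffF, Function.comp_apply]
    simp only [fanoutFn_apply, Function.comp_apply, hcU, hcX, subFn_boolPair, addFn_boolPair, bitsToNat_encodeNat]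
    rw [tsub_add_tsub_eq_natAbs]
  rw [farGF, notFn_apply (b := decide (4 * pD.eval n * (((PP pR pN pB (pD.eval n) n).cntX (ansBits ans) i k r' : ℤ) -
      (PP pR pN pB (pD.eval n) n).cntU (ansBits ans)).natAbs < pN.eval n))]
  · simp only [Params.far, PP_N, PP_D, not_decide_lt]
    exact congrArg (fun b : Bool => [b]) (by rw [Bool.eq_iff_iff]; simp only [decide_eq_true_eq])
  · simp only [Function.comp_apply, fanoutFn_apply, fstF_boolPair, habs, unF_wOut S r ans htot, polyFn_apply,
      List.length_replicate, eval_mul, eval_ofNat, lenBinF_apply, uNF_wOut pR pN pB _ S r ans htot, prodFn_boolPair,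
      bitsToNat_encodeNat, ltFn_boolPair]

end Far

/-! ### The rule: `passes`, `guess`, the code of the secret -/

section Rule

variable (pR pN pB pD : Polynomial ℕ)

/-- The group index `1^{(i·B + k)·R + r}` on the piece argument `⟨⟨w, ⟨1ⁱ, 1ᵏ⟩⟩, 1ʳ⟩` of the `passes` fold. [folklore] -/
noncomputable def gUF : List Bool → List Bool :=
  concatFn ∘ fanoutFn (umulFn ∘ fanoutFn (concatFn ∘ fanoutFn (umulFn ∘ fanoutFn (fstF ∘ sndF ∘ fstF) (uBF pB ∘ fstF ∘ fstF))
    (sndF ∘ sndF ∘ fstF)) (uRF pR ∘ fstF ∘ fstF)) sndF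

/-- The piece of the `passes` fold: the `far` bit of `(i, k, r)`. [folklore] -/
noncomputable def passPieceF : List Bool → List Bool := farGF pN pD ∘ fanoutFn (fstF ∘ fstF) (gUF pR pB)

/-- **`passes i k`** on `v = ⟨w, ⟨1ⁱ, 1ᵏ⟩⟩`: the OR over `r < R` of the `far` bits.
[cite: RegevLWE2009, §4 (proof of Lemma 4.2: "using `W` we can test whether `k = s₁`")] -/
noncomputable def passesF : List Bool → List Bool :=
  sndPow 2 ∘ foldLoop orBitOp (passPieceF pR pN pB pD) X ∘
    fanoutFn id (fanoutFn (lenBinF ∘ uRF pR ∘ fstF) (fanoutFn (fun _ => []) (fun _ => [false])))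

/-- The piece of the `guess` fold on `⟨⟨w, 1ⁱ⟩, 1ᵏ⟩`: `⟨[passes i k], 1ᵏ⟩`. [folklore] -/
noncomputable def guessPieceF : List Bool → List Bool :=
  fanoutFn (passesF pR pN pB pD ∘ fanoutFn (fstF ∘ fstF) (fanoutFn (sndF ∘ fstF) sndF)) sndF

/-- **`guess i` in unary** on `⟨w, 1ⁱ⟩`: the least passing `k < B`, else `0`.
[cite: RegevLWE2009, §4 (proof of Lemma 4.2: "only `p` possibilities for `s₁` … try all of them")] -/
noncomputable def guessUF : List Bool → List Bool :=
  dropFn ∘ fanoutFn (fun _ => [true]) (sndPow 2 ∘ foldLoop firstHitOp (clipF 4 (guessPieceF pR pN pB pD)) X ∘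
    fanoutFn id (fanoutFn (lenBinF ∘ uBF pB ∘ fstF) (fanoutFn (fun _ => []) (fun _ => []))))

/-- The piece of the output fold on `⟨w, 1ⁱ⟩`: `⟨bin (guess i mod q), ε⟩`. [folklore] -/
noncomputable def resPieceF : List Bool → List Bool :=
  fanoutFn (remFn ∘ fanoutFn (lenBinF ∘ guessUF pR pN pB pD) (hqF ∘ fstF)) (fun _ => [])

/-- The coded list of the residue codes of the guessed secret, on `w`. [folklore] -/
noncomputable def bodySecF : List Bool → List Bool :=
  sndPow 2 ∘ foldLoop appF (clipF 2 (resPieceF pR pN pB pD)) X ∘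
    fanoutFn id (fanoutFn (lenBinF ∘ unF) (fanoutFn (fun _ => []) (fun _ => [])))

/-- **The output map** of the reduction: the code `⟨⟨1ⁿ, ⟪bin ŝ₀, …⟫⟩, ε⟩` of the guessed secret
(`encodeSecret`). [cite: RegevLWE2009, §4 Lemma 4.2] -/
noncomputable def outFn : List Bool → List Bool := fanoutFn (fanoutFn unF (bodySecF pR pN pB pD)) (fun _ => [])

/-! #### Polynomial time -/

/-- `passPieceF ∈ FP` and it is one-bit. [folklore] -/
theorem passPieceF_mem_FP : passPieceF pR pN pB pD ∈ FP ∧ OneBit (passPieceF pR pN pB pD) := by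
  obtain ⟨hR, -, hB, -, -, -, -⟩ := params_mem_FP pR pN pB
  have hff : fstF ∘ fstF ∈ FP := comp_mem_FP fstF_mem_FP fstF_mem_FP
  have hg : gUF pR pB ∈ FP :=
    comp_mem_FP concatFn_mem_FP (fanoutFn_mem_FP (comp_mem_FP umulFn_mem_FP (fanoutFn_mem_FP
      (comp_mem_FP concatFn_mem_FP (fanoutFn_mem_FP (comp_mem_FP umulFn_mem_FP (fanoutFn_mem_FP
        (comp_mem_FP fstF_mem_FP (comp_mem_FP sndF_mem_FP fstF_mem_FP)) (comp_mem_FP hB hff)))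
        (comp_mem_FP sndF_mem_FP (comp_mem_FP sndF_mem_FP fstF_mem_FP)))) (comp_mem_FP hR hff))) sndF_mem_FP)
  exact ⟨comp_mem_FP (farGF_mem_FP pN pD) (fanoutFn_mem_FP hff hg), (oneBit_farGF pN pD).comp _⟩

/-- `passesF ∈ FP`. [folklore] -/
theorem passesF_mem_FP : passesF pR pN pB pD ∈ FP := by
  obtain ⟨hR, -, -, -, -, -, -⟩ := params_mem_FP pR pN pB
  obtain ⟨hp, hp1⟩ := passPieceF_mem_FP pR pN pB pD
  have hloop : foldLoop orBitOp (passPieceF pR pN pB pD) X ∈ FP :=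
    foldLoop_mem_FP (C := 1) orBitOp_mem_FP length_orOp_le hp (fun w => by rw [hp1.length_eq]; omega) X
  exact comp_mem_FP (sndPow_mem_FP 2) (comp_mem_FP hloop (fanoutFn_mem_FP OracleCompose.id_mem_FP
    (fanoutFn_mem_FP (comp_mem_FP lenBinF_mem_FP (comp_mem_FP hR fstF_mem_FP)) (fanoutFn_mem_FP (const_mem_FP _) (const_mem_FP _)))))

/-- `guessUF ∈ FP`. [folklore] -/
theorem guessUF_mem_FP : guessUF pR pN pB pD ∈ FP := by
  obtain ⟨-, -, hB, -, -, -, -⟩ := params_mem_FP pR pN pB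
  have hp := passesF_mem_FP pR pN pB pD
  have hpiece : guessPieceF pR pN pB pD ∈ FP := fanoutFn_mem_FP (comp_mem_FP hp (fanoutFn_mem_FP (comp_mem_FP fstF_mem_FP fstF_mem_FP)
    (fanoutFn_mem_FP (comp_mem_FP sndF_mem_FP fstF_mem_FP) sndF_mem_FP))) sndF_mem_FP
  have hloop := foldLoop_clipF_mem_FP 4 firstHitOp_mem_FP length_firstOp_le hpiece X
  exact comp_mem_FP dropFn_mem_FP (fanoutFn_mem_FP (const_mem_FP _) (comp_mem_FP (sndPow_mem_FP 2) (comp_mem_FP hloop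
    (fanoutFn_mem_FP OracleCompose.id_mem_FP (fanoutFn_mem_FP (comp_mem_FP lenBinF_mem_FP (comp_mem_FP hB fstF_mem_FP))
      (fanoutFn_mem_FP (const_mem_FP _) (const_mem_FP _)))))))

/-- **`outFn ∈ FP`.** [cite: AroraBarak2009, §1.3] -/
theorem outFn_mem_FP : outFn pR pN pB pD ∈ FP := by
  obtain ⟨-, -, -, hhq, -, -, hun⟩ := parse_mem_FP
  have hres : resPieceF pR pN pB pD ∈ FP := fanoutFn_mem_FP (comp_mem_FP remFn_mem_FP (fanoutFn_mem_FP
    (comp_mem_FP lenBinF_mem_FP (guessUF_mem_FP pR pN pB pD)) (comp_mem_FP hhq fstF_mem_FP))) (const_mem_FP _)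
  have hloop := foldLoop_clipF_mem_FP 2 appF_mem_FP length_appF_le hres X
  have hbody : bodySecF pR pN pB pD ∈ FP := comp_mem_FP (sndPow_mem_FP 2) (comp_mem_FP hloop (fanoutFn_mem_FP OracleCompose.id_mem_FP
    (fanoutFn_mem_FP (comp_mem_FP lenBinF_mem_FP hun) (fanoutFn_mem_FP (const_mem_FP _) (const_mem_FP _)))))
  exact fanoutFn_mem_FP (fanoutFn_mem_FP hun hbody) (const_mem_FP _)

/-! #### Values on the intended inputs -/

section Values

variable {S : Fin ((PP pR pN pB (pD.eval n) n).total n m) → (Fin n → ZMod q) × ZMod q} {r : List Bool}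
  {ans : List (List Bool)}

/-- Abbreviation of the hypotheses: nonempty input, `n, R, N ≥ 1`, enough answers. [folklore] -/
structure Good (pR pN pB pD : Polynomial ℕ) {n q m : ℕ} (S : Fin ((PP pR pN pB (pD.eval n) n).total n m) → (Fin n → ZMod q) × ZMod q)
    (ans : List (List Bool)) : Prop where
  /-- the tuple is nonempty -/
  htot : 0 < (PP pR pN pB (pD.eval n) n).total n m
  /-- positive dimension -/
  hn : 0 < n
  /-- at least one shift -/
  hR : 0 < pR.eval n
  /-- at least one repetition -/
  hN : 0 < pN.eval n
  /-- all queries answered -/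
  hans : (PP pR pN pB (pD.eval n) n).numQueries n ≤ ans.length

variable {pR pN pB pD}

/-- Consequences of `Good`: `R, N, B ≤ m' ≤ |w|`, `n ≤ |w|`, `|bin q| ≤ |w|`, `0 < m`. [folklore] -/
theorem Good.bounds (h : Good pR pN pB pD S ans) (r : List Bool) :
    pR.eval n ≤ (wOut S r ans).length ∧ pN.eval n ≤ (wOut S r ans).length ∧ pB.eval n ≤ (wOut S r ans).length ∧
      n ≤ (wOut S r ans).length ∧ (encodeNat q).length ≤ (wOut S r ans).length ∧
      pN.eval n ≤ (PP pR pN pB (pD.eval n) n).total n m ∧ 0 < m := by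
  obtain ⟨hle, hnle, hqle⟩ := lengths_le_wOut pR pN pB (pD.eval n) S r ans h.htot
  obtain ⟨-, hm⟩ := pos_of_total_pos h.htot
  obtain ⟨h1, h2, h3⟩ := params_le_total pR pN pB (pD.eval n) h.hn hm h.hR h.hN (m := m)
  exact ⟨h1.trans hle, h2.trans hle, h3.trans hle, hnle, hqle, h2, hm⟩

/-- `gUF` computes the group index. [folklore] -/
theorem gUF_value (h : Good pR pN pB pD S ans) (i k r' : ℕ) :
    gUF pR pB (boolPair (boolPair (wOut S r ans) (boolPair (ones i) (ones k))) (ones r')) =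
      ones ((PP pR pN pB (pD.eval n) n).gIdx i k r') := by
  rw [gUF, Function.comp_apply]
  simp only [fanoutFn_apply, Function.comp_apply, fstF_boolPair, sndF_boolPair, umulFn_apply, concatFn_boolPair,
    uBF_wOut pR pN pB _ S r ans h.htot, uRF_wOut pR pN pB _ S r ans h.htot, List.length_replicate,
    Com.ones_append, Params.gIdx, PP_B, PP_R]

/-- `passPieceF` computes the `far` bit of `(i, k, r)`. [folklore] -/
theorem passPieceF_value (h : Good pR pN pB pD S ans) {i k r' : ℕ} (hi : i < n) (hk : k < pB.eval n) (hr : r' < pR.eval n) :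
    passPieceF pR pN pB pD (boolPair (boolPair (wOut S r ans) (boolPair (ones i) (ones k))) (ones r')) =
      [(PP pR pN pB (pD.eval n) n).far ((PP pR pN pB (pD.eval n) n).cntX (ansBits ans) i k r')
        ((PP pR pN pB (pD.eval n) n).cntU (ansBits ans))] := by
  obtain ⟨-, -, -, -, -, hNtot, -⟩ := h.bounds r
  rw [passPieceF, Function.comp_apply, fanoutFn_apply, Function.comp_apply, fstF_boolPair, fstF_boolPair, gUF_value h]
  exact farGF_value h.htot hNtot (Params.gIdx_lt hi hk hr) h.hans

/-- **`passesF` computes `Params.passes`.** [cite: RegevLWE2009, §4 (proof of Lemma 4.2)] -/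
theorem passesF_value (h : Good pR pN pB pD S ans) {i k : ℕ} (hi : i < n) (hk : k < pB.eval n) :
    passesF pR pN pB pD (boolPair (wOut S r ans) (boolPair (ones i) (ones k))) =
      [(PP pR pN pB (pD.eval n) n).passes (ansBits ans) i k] := by
  obtain ⟨hRle, -, -, -, -, -, -⟩ := h.bounds r
  have hRv : pR.eval n ≤ (X : Polynomial ℕ).eval (boolPair (wOut S r ans) (boolPair (ones i) (ones k))).length := by
    rw [eval_X, length_boolPair]; omega
  rw [passesF, Function.comp_apply, Function.comp_apply, fanoutFn_apply, fanoutFn_apply, fanoutFn_apply, Function.comp_apply,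
    Function.comp_apply, id, fstF_boolPair, uRF_wOut pR pN pB _ S r ans h.htot, lenBinF_apply, List.length_replicate]
  show sndPow 2 (foldLoop orBitOp (passPieceF pR pN pB pD) X (boolPair _ (boolPair (encodeNat (pR.eval n)) (boolPair (ones 0) [false])))) = _
  rw [foldLoop_apply _ _ hRv 0, sndPow_succ_boolPair, sndPow_succ_boolPair, sndPow_zero, sndF_boolPair, foldAcc_orOp]
  refine congrArg (fun b : Bool => [b]) ?_
  rw [Bool.eq_iff_iff, decide_eq_true_eq, Params.passes, List.any_eq_true]
  constructor
  · rintro ⟨r', hr', hb⟩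
    refine ⟨r', List.mem_range.2 (by simpa using hr'), ?_⟩
    rwa [passPieceF_value h hi hk (by simpa using hr'), List.headD_cons] at hb
  · rintro ⟨r', hr', hb⟩
    have hr'' : r' < pR.eval n := by simpa using List.mem_range.1 hr'
    refine ⟨r', hr'', ?_⟩
    rw [passPieceF_value h hi hk hr'', List.headD_cons]
    exact hb

/-- `guessPieceF` computes `⟨[passes i k], 1ᵏ⟩`. [folklore] -/
theorem guessPieceF_value (h : Good pR pN pB pD S ans) {i k : ℕ} (hi : i < n) (hk : k < pB.eval n) :
    guessPieceF pR pN pB pD (boolPair (boolPair (wOut S r ans) (ones i)) (ones k)) =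
      boolPair [(PP pR pN pB (pD.eval n) n).passes (ansBits ans) i k] (ones k) := by
  rw [guessPieceF, fanoutFn_apply, Function.comp_apply, fanoutFn_apply, fanoutFn_apply, Function.comp_apply, Function.comp_apply,
    fstF_boolPair, fstF_boolPair, sndF_boolPair, sndF_boolPair, passesF_value h hi hk]

/-- **`guessUF` computes `Params.guess` in unary.** [cite: RegevLWE2009, §4 (proof of Lemma 4.2)] -/
theorem guessUF_value (h : Good pR pN pB pD S ans) {i : ℕ} (hi : i < n) :
    guessUF pR pN pB pD (boolPair (wOut S r ans) (ones i)) = ones ((PP pR pN pB (pD.eval n) n).guess (ansBits ans) i) := by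
  obtain ⟨-, -, hBle, -, -, -, -⟩ := h.bounds r
  set xk := boolPair (wOut S r ans) (ones i) with hxk
  have hBx : pB.eval n ≤ (X : Polynomial ℕ).eval xk.length := by rw [eval_X, hxk, length_boolPair]; omega
  have hloop : sndPow 2 (foldLoop firstHitOp (clipF 4 (guessPieceF pR pN pB pD)) X
      (boolPair xk (boolPair (encodeNat (pB.eval n)) (boolPair [] [])))) =
      match (List.range (pB.eval n)).find? (fun k => (PP pR pN pB (pD.eval n) n).passes (ansBits ans) i k) with
      | none => [] | some k => true :: ones k := by
    show sndPow 2 (foldLoop firstHitOp (clipF 4 (guessPieceF pR pN pB pD)) X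
      (boolPair xk (boolPair (encodeNat (pB.eval n)) (boolPair (ones 0) [])))) = _
    rw [foldLoop_apply _ _ hBx 0, sndPow_succ_boolPair, sndPow_succ_boolPair, sndPow_zero, sndF_boolPair, foldAcc_clipF,
      foldAcc_firstOp _ _ (fun k => (PP pR pN pB (pD.eval n) n).passes (ansBits ans) i k)]
    · intro k hk
      rw [hxk, guessPieceF_value h hi hk]
    · intro j _ hj
      rw [Nat.zero_add] at hj
      rw [hxk, guessPieceF_value h hi hj, length_boolPair, List.length_singleton, List.length_replicate, ← hxk]
      have : j < xk.length := by rw [hxk, length_boolPair]; omega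
      omega
  rw [guessUF, Function.comp_apply, fanoutFn_apply, Function.comp_apply, Function.comp_apply, fanoutFn_apply, fanoutFn_apply,
    fanoutFn_apply, Function.comp_apply, Function.comp_apply, id, fstF_boolPair, uBF_wOut pR pN pB _ S r ans h.htot, lenBinF_apply,
    List.length_replicate, hloop, dropFn_boolPair, List.length_singleton]
  simp only [Params.guess, PP_B]
  cases (List.range (pB.eval n)).find? (fun k => (PP pR pN pB (pD.eval n) n).passes (ansBits ans) i k) with
  | none => rfl
  | some k => rfl

/-- `resPieceF` computes `⟨bin (guess i mod q), ε⟩`. [folklore] -/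
theorem resPieceF_value [NeZero q] (h : Good pR pN pB pD S ans) {i : ℕ} (hi : i < n) :
    resPieceF pR pN pB pD (boolPair (wOut S r ans) (ones i)) =
      boolPair (encodeNat ((PP pR pN pB (pD.eval n) n).guess (ansBits ans) i % q)) [] := by
  rw [resPieceF, fanoutFn_apply, Function.comp_apply, fanoutFn_apply, Function.comp_apply, Function.comp_apply, fstF_boolPair,
    hqF_wOut, guessUF_value h hi, lenBinF_apply, List.length_replicate, remFn_boolPair, bitsToNat_encodeNat, bitsToNat_encodeNat]

/-- **`bodySecF` computes the coded list of the residue codes of the guessed secret.** [folklore] -/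
theorem bodySecF_value [NeZero q] (h : Good pR pN pB pD S ans) :
    bodySecF pR pN pB pD (wOut S r ans) =
      encList (List.ofFn fun i : Fin n => encodeNat ((PP pR pN pB (pD.eval n) n).guess (ansBits ans) i.val % q)) := by
  obtain ⟨-, -, -, hnle, hqle, -, -⟩ := h.bounds r
  have hnx : n ≤ (X : Polynomial ℕ).eval (wOut S r ans).length := by rw [eval_X]; exact hnle
  rw [bodySecF, Function.comp_apply, Function.comp_apply, fanoutFn_apply, fanoutFn_apply, fanoutFn_apply, Function.comp_apply, id,
    unF_wOut S r ans h.htot, lenBinF_apply, List.length_replicate]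
  show sndPow 2 (foldLoop appF (clipF 2 (resPieceF pR pN pB pD)) X
    (boolPair (wOut S r ans) (boolPair (encodeNat n) (boolPair (ones 0) [])))) = _
  rw [foldLoop_apply _ _ hnx 0, sndPow_succ_boolPair, sndPow_succ_boolPair, sndPow_zero, sndF_boolPair, foldAcc_clipF,
    foldAcc_appF, List.nil_append,
    ← ccat_boolPair_nil_eq_encList (fun j => encodeNat ((PP pR pN pB (pD.eval n) n).guess (ansBits ans) j % q))]
  · exact ccat_congr fun j hj => by rw [Nat.zero_add, resPieceF_value h hj]
  · intro j _ hj
    rw [Nat.zero_add] at hj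
    rw [resPieceF_value h hj, length_boolPair, List.length_nil]
    have := length_encodeNat_mono (Nat.mod_lt ((PP pR pN pB (pD.eval n) n).guess (ansBits ans) j) (NeZero.pos q)).le
    omega

/-- **Specification of the output map**: on `⟨⟨encodeLWESamples S, r⟩, code ans⟩` (nonempty tuple,
`n, R, N ≥ 1`, at least `N + G·N` answers) the output is the code of the secret guessed by the rule of
part I from the head bits of the answers. [cite: RegevLWE2009, §4 Lemma 4.2] -/
theorem outFn_spec [NeZero q] (h : Good pR pN pB pD S ans) :
    outFn pR pN pB pD (wOut S r ans) = encodeSecret ((PP pR pN pB (pD.eval n) n).solveBits n q (ansBits ans)) := by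
  rw [outFn, fanoutFn_apply, fanoutFn_apply, unF_wOut S r ans h.htot, bodySecF_value h, encodeSecret,
    encodingFinVec_encode_eq]
  simp only [Params.solveBits, ZMod.val_natCast]
  rfl

end Values

end Rule

end DecisionToSearch

end LWE

end Literature.Computability.Cryptography

end

/-! ## Part V — the machine, the parameters, the discharge -/

noncomputable section

open Filter Polynomial Literature.Computability.Complexity Literature.Computability.Cryptography.LWE
  Literature.Computability.Cryptography.LWE.DecisionToSearch
open scoped ENNReal

namespace Literature.Computability.Cryptography

namespace RegevDecisionToSearch

/-! ### Two small facts about `PMF`s -/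

/-- With NO samples both branches of the decision experiment are the point mass on the empty tuple,
so every distinguisher has advantage `0`. [folklore] -/
theorem distinguishingAdvantage_zero_samples {n q : ℕ} [NeZero q] (χ : PMF (ZMod q))
    (D : LWE.Distinguisher (Fin n) (ZMod q) 0) : LWE.distinguishingAdvantage χ 0 D = 0 := by
  have hpt : ∀ (p r : PMF (Fin 0 → (Fin n → ZMod q) × ZMod q)), p = r := fun p r => by
    ext v
    have hv : ∀ w : Fin 0 → (Fin n → ZMod q) × ZMod q, w = v := fun w => funext fun i => i.elim0
    have hp : p v = 1 := by
      have := p.tsum_coe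
      rwa [tsum_eq_single v (fun w hw => absurd (hv w) hw)] at this
    have hr : r v = 1 := by
      have := r.tsum_coe
      rwa [tsum_eq_single v (fun w hw => absurd (hv w) hw)] at this
    rw [hp, hr]
  unfold LWE.distinguishingAdvantage
  rw [hpt (LWE.lweSamplesUniformSecret χ 0) (LWE.uniformSamples (Fin n) (ZMod q) 0), sub_self, abs_zero]

/-! ### The parameters -/

section Params

variable (c c' : ℕ) (Bq : Polynomial ℕ)

/-- `D = n^c`. [cite: RegevLWE2009, §4 Lemma 4.1 (proof: advantage `n^{-c₂}`)] -/
def pD : Polynomial ℕ := X ^ c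
/-- `R = 4 n^{c+c'} + 1` shifts. [cite: RegevLWE2009, §4 Lemma 4.1 (proof: "Repeat … n^{c₁+1} times")] -/
def pR : Polynomial ℕ := 4 * X ^ (c + c') + 1
/-- `N = 128 n^{2c} (1 + n B R) n^{c'} + 1` calls per estimate. [cite: RegevLWE2009, §4 Lemma 4.1 (proof: "O(n^{2c₂+1}) times")] -/
def pN : Polynomial ℕ := 128 * X ^ (2 * c) * (1 + X * Bq * pR c c') * X ^ c' + 1
/-- The number of units `K = R + (N + n B R · N)` as a polynomial. [folklore] -/
def pK : Polynomial ℕ := pR c c' + (pN c c' Bq + X * Bq * pR c c' * pN c c' Bq)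

/-- The parameters at dimension `n`. [folklore] -/
theorem PP_eq (n : ℕ) : DecisionToSearch.PP (pR c c') (pN c c' Bq) Bq ((pD c).eval n) n =
    ⟨(pR c c').eval n, (pN c c' Bq).eval n, Bq.eval n, (pD c).eval n⟩ := rfl

/-- `K(n)` is the value of `pK`. [folklore] -/
theorem K_eq (n : ℕ) : (DecisionToSearch.PP (pR c c') (pN c c' Bq) Bq ((pD c).eval n) n).K n = (pK c c' Bq).eval n := by
  simp [Params.K, Params.groups, DecisionToSearch.PP, pK]

/-- `D, R, N` are positive for `n ≥ 1`. [folklore] -/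
theorem params_pos {n : ℕ} (hn : 0 < n) : 0 < (pD c).eval n ∧ 0 < (pR c c').eval n ∧ 0 < (pN c c' Bq).eval n := by
  exact ⟨by simpa [pD] using Nat.pow_pos hn, by simp [pR], by simp [pN]⟩

/-- **The failure bound is at most `1/n^{c'}`** for `n ≥ 1`: `2D/R ≤ 1/(2n^{c'})` and
`64 D² (1 + nBR)/N ≤ 1/(2n^{c'})`. [cite: RegevLWE2009, §4 Lemma 4.1 (proof: choice of the numbers of iterations and calls)] -/
theorem failBound_le {n : ℕ} (hn : 0 < n) :
    failBound (DecisionToSearch.PP (pR c c') (pN c c' Bq) Bq ((pD c).eval n) n) n ≤ 1 / (n : ℝ) ^ c' := by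
  have hnpos : (0 : ℝ) < n := by exact_mod_cast hn
  have hD : ((DecisionToSearch.PP (pR c c') (pN c c' Bq) Bq ((pD c).eval n) n).D : ℝ) = (n : ℝ) ^ c := by
    simp only [DecisionToSearch.PP, pD, eval_pow, eval_X]; push_cast; ring
  have hR : ((DecisionToSearch.PP (pR c c') (pN c c' Bq) Bq ((pD c).eval n) n).R : ℝ) = 4 * ((n : ℝ) ^ c * (n : ℝ) ^ c') + 1 := by
    simp only [DecisionToSearch.PP, pR, eval_add, eval_mul, eval_pow, eval_X, eval_one, eval_ofNat]; push_cast; ring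
  have hB : ((DecisionToSearch.PP (pR c c') (pN c c' Bq) Bq ((pD c).eval n) n).B : ℝ) = ((Bq.eval n : ℕ) : ℝ) := by
    simp only [DecisionToSearch.PP]
  have hN : ((DecisionToSearch.PP (pR c c') (pN c c' Bq) Bq ((pD c).eval n) n).N : ℝ) =
      128 * ((n : ℝ) ^ c) ^ 2 * (1 + n * ((Bq.eval n : ℕ) : ℝ) * (4 * ((n : ℝ) ^ c * (n : ℝ) ^ c') + 1)) * (n : ℝ) ^ c' + 1 := by
    simp only [DecisionToSearch.PP, pN, pR, eval_add, eval_mul, eval_pow, eval_X, eval_one, eval_ofNat]; push_cast; ring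
  unfold failBound
  rw [hD, hR, hB, hN]
  have hdpos : (0 : ℝ) < (n : ℝ) ^ c := by positivity
  have hepos : (0 : ℝ) < (n : ℝ) ^ c' := by positivity
  have hb0 : (0 : ℝ) ≤ ((Bq.eval n : ℕ) : ℝ) := by positivity
  generalize (n : ℝ) ^ c = d at hdpos ⊢
  generalize (n : ℝ) ^ c' = e at hepos ⊢
  generalize ((Bq.eval n : ℕ) : ℝ) = b at hb0 ⊢
  have h1 : 2 * d / (4 * (d * e) + 1) ≤ 1 / (2 * e) := by
    rw [div_le_div_iff₀ (by positivity) (by positivity)]; nlinarith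
  have h2 : 64 * d ^ 2 * (1 + n * b * (4 * (d * e) + 1)) / (128 * d ^ 2 * (1 + n * b * (4 * (d * e) + 1)) * e + 1) ≤ 1 / (2 * e) := by
    rw [div_le_div_iff₀ (by positivity) (by positivity)]; nlinarith [mul_nonneg (mul_nonneg hnpos.le hb0) hdpos.le]
  calc _ ≤ 1 / (2 * e) + 1 / (2 * e) := add_le_add h1 h2
    _ = 1 / e := by field_simp; norm_num

end Params

/-! ### The machine and its solver -/

section Machine

variable (c c' : ℕ) (Bq : Polynomial ℕ)

/-- **The oracle algorithm of the reduction**: ask the queries of `queryFn`, output by `outFn`.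
[cite: RegevLWE2009, §4 Lemma 4.1–4.2] -/
def redAlg : OracleAlg (List Bool) :=
  ttFnAlgL (queryFn (pR c c') (pN c c' Bq) Bq (9 * (X + 1) ^ 2)) X (outFn (pR c c') (pN c c' Bq) Bq (pD c))

/-- The sample budget `m' n = K(n) · 2 m n`. [folklore] -/
def budget (m : ℕ → ℕ) (n : ℕ) : ℕ := (DecisionToSearch.PP (pR c c') (pN c c' Bq) Bq ((pD c).eval n) n).total n (m n)

/-- The machine is polynomial time. [cite: AroraBarak2009, §1.3] -/
theorem redAlg_isPolyTime : (redAlg c c' Bq).IsPolyTime (Computability.encodingList Bool) :=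
  isPolyTime_ttFnAlgL (queryFn_mem_FP _ _ _ _) (outFn_mem_FP _ _ _ _)

/-- The sample budget is polynomially bounded when `m` is. [folklore] -/
theorem isPolyBounded_budget {m : ℕ → ℕ} (hm : IsPolyBounded m) : IsPolyBounded (budget c c' Bq m) := by
  obtain ⟨Bm, hBm⟩ := hm
  refine ⟨pK c c' Bq * (2 * Bm), fun n => ?_⟩
  unfold budget Params.total
  rw [K_eq, eval_mul, eval_mul, eval_ofNat]
  have := hBm n
  exact Nat.mul_le_mul_left _ (by omega)

/-- The acceptance predicate presented by the oracle: the first bit of its answer on the code of a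
block. [cite: RegevLWE2009, §4 (the distinguisher `W`)] -/
def accOf {n q m : ℕ} (O : Oracle) (blk : Fin m → (Fin n → ZMod q) × ZMod q) : Bool :=
  decide (IsAccepting (O (encodeLWESamples blk)))

/-- `IsAccepting w` is "the head bit of `w` is `1`". [folklore] -/
theorem isAccepting_iff_headD (w : List Bool) : IsAccepting w ↔ w.headD false = true := by
  cases w with
  | nil => simp [IsAccepting]
  | cons b w => simp [IsAccepting]

variable {c c' Bq}

/-- **The run of the machine on a nonempty sample tuple**: whatever the coins `r` (of length `0`), it
halts within the fuel `2|x| + 3` with the code of `Params.solve acc S`. [cite: RegevLWE2009, §4 Lemma 4.1–4.2] -/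
theorem run_redAlg {n : ℕ} {q : ℕ} [NeZero q] {m : ℕ} (O : Oracle)
    (S : Fin ((DecisionToSearch.PP (pR c c') (pN c c' Bq) Bq ((pD c).eval n) n).total n m) → (Fin n → ZMod q) × ZMod q)
    (hn : 0 < n) (hm : 0 < m) (r : List Bool) (hr : r.length = 0) :
    (redAlg c c' Bq).run O ((2 * X + 3 : Polynomial ℕ).eval (encodeLWESamples S).length) (boolPair (encodeLWESamples S) r) =
      some (encodeSecret ((DecisionToSearch.PP (pR c c') (pN c c' Bq) Bq ((pD c).eval n) n).solve (accOf O) S)) := by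
  obtain ⟨hDpos, hRpos, hNpos⟩ := params_pos c c' Bq hn
  have htot : 0 < (DecisionToSearch.PP (pR c c') (pN c c' Bq) Bq ((pD c).eval n) n).total n m :=
    Nat.mul_pos (Nat.add_pos_left (by simpa using hRpos) _) (by omega)
  have hfuel : (X : Polynomial ℕ).eval (boolPair (encodeLWESamples S) r).length <
      (2 * X + 3 : Polynomial ℕ).eval (encodeLWESamples S).length := by
    simp only [eval_X, eval_add, eval_mul, eval_ofNat, length_boolPair, hr]; omega
  rw [redAlg, run_ttFnAlgL O _ hfuel, ttFnL_apply]
  -- the transcript and the output map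
  set ans := (ttQueries (queryFn (pR c c') (pN c c' Bq) Bq (9 * (X + 1) ^ 2)) (boolPair (encodeLWESamples S) r)
    (X.eval (boolPair (encodeLWESamples S) r).length)).map O with hans
  have hlen : (DecisionToSearch.PP (pR c c') (pN c c' Bq) Bq ((pD c).eval n) n).numQueries n ≤ ans.length := by
    rw [hans, List.length_map, length_ttQueries, eval_X, length_boolPair]
    obtain ⟨-, -, h3⟩ := le_length_encodeLWESamples htot S
    have : (DecisionToSearch.PP (pR c c') (pN c c' Bq) Bq ((pD c).eval n) n).numQueries n ≤
        (DecisionToSearch.PP (pR c c') (pN c c' Bq) Bq ((pD c).eval n) n).total n m := by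
      unfold Params.numQueries Params.total Params.K; nlinarith
    omega
  have hgood : Good (pR c c') (pN c c' Bq) Bq (pD c) S ans := ⟨htot, hn, hRpos, hNpos, hlen⟩
  rw [show boolPair (boolPair (encodeLWESamples S) r) ((Computability.encodingList Bool).listBool.encode ans) = wOut S r ans from rfl,
    outFn_spec hgood, Params.solve]
  congr 2
  refine (DecisionToSearch.PP (pR c c') (pN c c' Bq) Bq ((pD c).eval n) n).solveBits_congr fun b hb => ?_
  -- the `b`-th answer bit is the verdict on the `b`-th query
  have hbq : b < (ttQueries (queryFn (pR c c') (pN c c' Bq) Bq (9 * (X + 1) ^ 2)) (boolPair (encodeLWESamples S) r)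
      (X.eval (boolPair (encodeLWESamples S) r).length)).length := by
    rw [length_ttQueries]; rw [hans, List.length_map, length_ttQueries] at hlen; omega
  rw [ansBits, hans, List.getD_eq_getElem _ _ (by rw [List.length_map]; exact hbq), List.getElem_map, getElem_ttQueries,
    show boolPair (boolPair (encodeLWESamples S) r) (List.replicate b true) = zIn S r b from rfl,
    queryFn_spec _ _ _ _ S r htot hb, Params.bitsOf, accOf]
  by_cases hacc : IsAccepting (O (encodeLWESamples (Params.qry S b)))
  · rw [decide_eq_true hacc, (isAccepting_iff_headD _).1 hacc]
  · rw [decide_eq_false hacc]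
    cases hh : (O (encodeLWESamples (Params.qry S b))).headD false
    · rfl
    · exact absurd ((isAccepting_iff_headD _).2 hh) hacc

/-- **The solver presented by the machine is the deterministic rule of part I** (the coins, none, are
irrelevant). [cite: RegevLWE2009, §4 Lemma 4.1–4.2] -/
theorem solver_eq {n : ℕ} {q : ℕ} [NeZero q] {m : ℕ} (O : Oracle) (hn : 0 < n) (hm : 0 < m) :
    oracleSearchLWESolver (redAlg c c' Bq) O 0 (2 * X + 3) n q ((DecisionToSearch.PP (pR c c') (pN c c' Bq) Bq ((pD c).eval n) n).total n m) =
      fun S => PMF.pure ((DecisionToSearch.PP (pR c c') (pN c c' Bq) Bq ((pD c).eval n) n).solve (accOf O) S) := by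
  funext S
  rw [oracleSearchLWESolver, OracleAlg.randRun_eq_map, PMF.map_comp]
  refine Eq.trans (congrArg (fun f => PMF.map f _) (funext fun rv => ?_)) (PMF.map_const _ _)
  rw [Function.const_apply, Function.comp_apply, run_redAlg O S hn hm rv.toList (by rw [List.Vector.toList_length, eval_zero]), Option.getD_some,
    decodeSecret_encodeSecret]

end Machine

/-! ### The discharge -/

/-- **Discharge of `regev_decision_to_search`** (pqc.S22; Regev 2009, Lemma 4.2 with Lemma 4.1,
p. 23 of the held copy arXiv:2401.03703). For a prime, polynomially bounded modulus `q = q(n)`, any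
noise `χ`, polynomially bounded `m` and all `c, c'`: the coin-free truth-table oracle algorithm
`redAlg c c' Bq` (queries `queryFn`, output `outFn`; `Bq` the polynomial bound of `q`) with
`m' n = K(n)·2m n` samples turns every oracle of average-case decision-LWE advantage `≥ 1/n^c` (all
large `n`) into a search-LWE solver of success probability `≥ 1 - 1/n^{c'}` (all large `n`).
Regev's argument: re-randomise the secret by `R` uniform shifts `t` (Lemma 4.1: `s + t` is uniform,
so some shift lands in the `≥ ε/2`-fraction of good secrets, Markov), test every value `k < q ≤ B` of
every coordinate with the transformation `(a + l eᵢ, b + l k)` (Lemma 4.2: `A_{s,χ}` stays `A_{s,χ}` iff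
`k = sᵢ`, becomes uniform otherwise — `q` prime), estimate each acceptance frequency by `N` calls
(Chebyshev in place of Chernoff), and keep the first `k` whose estimate is far from the uniform one.
[cite: RegevLWE2009, §4 Lemma 4.1–4.2] -/
theorem regev_decision_to_search_holds' (q : ℕ → ℕ) [∀ n, NeZero (q n)] : regev_decision_to_search q := by
  intro χ m hprime hq hm c c'
  obtain ⟨Bq, hBq⟩ := hq
  refine ⟨redAlg c c' Bq, 0, 2 * X + 3, budget c c' Bq m, redAlg_isPolyTime c c' Bq, isPolyBounded_budget c c' Bq hm,
    fun O hO => ?_⟩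
  unfold SearchLWESolves
  have hO' : ∀ᶠ n : ℕ in atTop, (1 / (n : ℝ) ^ c) ≤
      LWE.distinguishingAdvantage (χ n) (m n) (fun blk => PMF.pure (accOf O blk)) := hO
  filter_upwards [hO', hprime, eventually_ge_atTop 1] with n hadv hpn hn1
  have hn : 0 < n := hn1
  haveI : Fact (Nat.Prime (q n)) := ⟨hpn⟩
  obtain ⟨hDpos, hRpos, hNpos⟩ := params_pos c c' Bq hn
  -- the advantage hypothesis forces `m n ≥ 1`
  have hm : 0 < m n := by
    rcases Nat.eq_zero_or_pos (m n) with h0 | h0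
    · exfalso
      have hpos : (0 : ℝ) < 1 / (n : ℝ) ^ c := by positivity
      have hzero : ∀ (k : ℕ) (D : LWE.Distinguisher (Fin n) (ZMod (q n)) k), k = 0 →
          LWE.distinguishingAdvantage (χ n) k D = 0 := by
        intro k D hk; subst hk; exact distinguishingAdvantage_zero_samples (χ n) D
      have hadv0 := hzero (m n) (fun blk => PMF.pure (accOf O blk)) h0
      linarith
    · exact h0
  -- part II, with `D = n^c`, `B ≥ q n`
  have hadv' : (1 / ((DecisionToSearch.PP (pR c c') (pN c c' Bq) Bq ((pD c).eval n) n).D : ℕ) : ℝ) ≤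
      LWE.distinguishingAdvantage (χ n) (m n)
        (fun blk : Fin (m n) → (Fin n → ZMod (q n)) × ZMod (q n) => PMF.pure (accOf O blk)) := by
    simpa [DecisionToSearch.PP, pD] using hadv
  have hmain := le_searchSuccessProb_solve (DecisionToSearch.PP (pR c c') (pN c c' Bq) Bq ((pD c).eval n) n) (χ n) (accOf O) hn hm
    (hBq n) hRpos hNpos hDpos hadv'
  show ENNReal.ofReal (1 - 1 / (n : ℝ) ^ c') ≤ LWE.searchSuccessProb (χ n) (budget c c' Bq m n)
    (oracleSearchLWESolver (redAlg c c' Bq) O 0 (2 * X + 3) n (q n) (budget c c' Bq m n))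
  unfold budget
  rw [solver_eq O hn hm]
  refine le_trans (ENNReal.ofReal_le_ofReal ?_) hmain
  linarith [failBound_le c c' Bq hn]

end RegevDecisionToSearch

section SearchDecision

variable (q : ℕ → ℕ) [∀ n, NeZero (q n)]

/-- **pqc.S22, discharged** (Regev 2009, Lemma 4.2 with Lemma 4.1): decision-LWE with average-case
advantage `≥ 1/n^c` on polynomially many samples yields search-LWE with success `≥ 1 - 1/n^{c'}`, by
one probabilistic polynomial-time oracle algorithm with a polynomial sample budget, for a prime
polynomially bounded modulus. See `RegevDecisionToSearch.regev_decision_to_search_holds'` and the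
`LWEDecisionToSearch*.lean` files for the construction and the analysis. [cite: RegevLWE2009, §4 Lemma 4.1–4.2] -/
theorem regev_decision_to_search_holds : regev_decision_to_search q :=
  RegevDecisionToSearch.regev_decision_to_search_holds' q

end SearchDecision

end Literature.Computability.Cryptography

end
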